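import Summits.CriticalPhenomena.SAWScalingLimit.Theorems.SAWDefectDecoherenceBoundaryClosureRPolygonLocalFlat
import Summits.CriticalPhenomena.SAWScalingLimit.Theorems.SAWDefectDecoherenceBoundaryClosureRPhaseGeometry
import HarnessLib

/-!
# Local constancy of the boundary phase on flat stretches and its gate normalisation
(crux `BoundaryClosureR`, stmt-CriticalPhenomena-14004, line `polygon-parity-squeeze`, sub-goal of the
registered stub `polygonLocalIdentity`, step (b); registered helper `kappa_const_on_flatBall`)

Given lattice phases `Θ_n(z)` with limit `κ(z)` along a filter `U ≤ atTop` and the PHASE PROPERTY on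
flat balls (every boundary dart `v ∼ t` with `δ c_v ∈ B(z, 3s/4)` has `F(vt)|F₀(b)| = Θ_n(z)|F₀(vt)|F(b)`,
eventually), we prove:

* `flatBall_sub`: sub-balls of a flat ball centred on the side line are flat balls (the points of the
  side line are boundary points: `PhaseGeometry.mem_frontier_of_level_eq_zero`);
* `kappa_localStep`: `κ w' = κ w` for a boundary point `w'` within `s_w/2` of the centre `w` of a flat
  ball (a dart near `w'` — `eventually_exists_dart_near` — carries both phases);
* **`kappa_const_on_flatBall`** (K2c): `κ` is constant on `∂P ∩ B(z, s)` for every flat ball `B(z, s)`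
  (chain of local steps along the side segment);
* `kappa_gate_eq_one` (K3): `κ = 1` on the gate `∂P ∩ B(pt 1, ρ)` (the normaliser `b_δ` lies on the
  gate stretch: `flat_phase_eq` with `e' = b_δ`).

References: Duminil-Copin–Smirnov 2012 §3.  No definition is introduced.
-/

noncomputable section

open scoped Topology ComplexConjugate
open Filter Set Metric
open Literature.Probability.LatticeModels Literature.Probability.RandomPlanarGeometry
open Literature.Probability.RandomPlanarGeometry.SAW
open Summit.CriticalPhenomena.SAWScalingLimit.Theorems.PickHalfPlane
open Summit.CriticalPhenomena.SAWScalingLimit.Theorems.PolygonParitySqueeze.PhaseGeometry (halfPlane_eq_of_level_eq_zero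
  level_eq_zero_of_mem_frontier mem_frontier_of_level_eq_zero)
open Summit.CriticalPhenomena.SAWScalingLimit.Theorems (ConjugateClassNegligibleSynthesis.dist_mid_center_le)

namespace Summit.CriticalPhenomena.SAWScalingLimit.Theorems.PolygonParitySqueeze.PolygonLocal

/-! ### 1. Geometry of flat balls -/

/-- Splitting of the signed level: `ℓ_z(y) = ℓ_w(y) + ℓ_z(w)`. [folklore] -/
theorem level_split (k : Fin 6) (z w y : ℂ) :
    ((y - z) * conj (innerNormal k)).re = ((y - w) * conj (innerNormal k)).re + ((w - z) * conj (innerNormal k)).re := by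
  rw [← Complex.add_re, ← add_mul, sub_add_sub_cancel]

/-- **Sub-balls of a flat ball centred on the side line are flat**: if `P ∩ B(z,s) = H_k(z) ∩ B(z,s)`,
`w ∈ B(z, s)` lies on the line and `s' ≤ s - dist w z`, then `P ∩ B(w,s') = H_k(w) ∩ B(w,s')`. [folklore] -/
theorem flatBall_sub {P : Set ℂ} {k : Fin 6} {z : ℂ} {s : ℝ} (hset : P ∩ ball z s = halfPlane k z ∩ ball z s)
    {w : ℂ} (hw : ((w - z) * conj (innerNormal k)).re = 0) {s' : ℝ} (hs' : s' ≤ s - dist w z) :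
    P ∩ ball w s' = halfPlane k w ∩ ball w s' := by
  have hsub : ball w s' ⊆ ball z s := fun y hy => by
    rw [mem_ball] at hy ⊢
    have := dist_triangle y w z
    linarith
  rw [halfPlane_eq_of_level_eq_zero hw]
  ext y
  constructor
  · rintro ⟨hyP, hyb⟩
    have : y ∈ P ∩ ball z s := ⟨hyP, hsub hyb⟩
    rw [hset] at this
    exact ⟨this.1, hyb⟩
  · rintro ⟨hyH, hyb⟩
    have : y ∈ halfPlane k z ∩ ball z s := ⟨hyH, hsub hyb⟩
    rw [← hset] at this
    exact ⟨this.1, hyb⟩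

/-! ### 2. The local step -/

/-- **Local step.**  If `B(w, s_w)` is a flat ball of form `k` off the root and `w' ∈ ∂P` is within
`s_w/2` of `w`, then `κ w' = κ w`: a boundary dart near `w'` (it exists eventually) carries both the phase
`Θ_n(w)` and the phase `Θ_n(w')`, so `Θ_n(w') = Θ_n(w)` eventually. [folklore] -/
theorem kappa_localStep {D : DobrushinDomain} {ρ : ℝ} {Λ : ℝ → Finset HexVertex} {m : ℝ → ℤ}
    {b : ℝ → Sym2 HexVertex} (hAF : AdmissibleFamily D ρ Λ m b) {a : ℝ → Sym2 HexVertex} {r₀ : ℝ}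
    {m₀ : ℝ → ℤ} (hPR : PinnedFlatRoot D Λ b (D.pt 0) a r₀ m₀) {ns : ℕ → ℝ}
    (hns : Tendsto ns atTop (𝓝[>] 0)) {U : Filter ℕ} (hUle : U ≤ atTop) [U.NeBot] {Θ : ℕ → ℂ → ℂ} {κ : ℂ → ℂ}
    (hκT : ∀ z : ℂ, Tendsto (fun n => Θ n z) U (𝓝 (κ z)))
    (hΘ2 : (∀ (z : ℂ) (k : Fin 6) (s : ℝ), 0 < s → (∀ᶠ δ : ℝ in 𝓝[>] 0, ∃ nthr : ℤ, ∀ v : HexVertex, (δ : ℂ) * hexCenter v ∈ Metric.ball z s → (v ∈ Λ δ ↔ nthr ≤ zigzagForm k v)) → D.pt 0 ∉ Metric.closedBall z s → ∀ᶠ n : ℕ in Filter.atTop, ∀ v t : HexVertex, v ∈ Λ (ns n) → t ∉ Λ (ns n) → hexGraph.Adj v t → ((ns n : ℝ) : ℂ) * hexCenter v ∈ Metric.ball z (3 * s / 4) → hexParafermionicObservable (Λ (ns n)) (a (ns n)) hexCriticalFugacity (5 / 8) s(v, t) * ((‖hexParafermionicObservable (Λ (ns n)) (a (ns n)) hexCriticalFugacity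 0 (b (ns n))‖ : ℝ) : ℂ) = Θ n z * ((‖hexParafermionicObservable (Λ (ns n)) (a (ns n)) hexCriticalFugacity 0 s(v, t)‖ : ℝ) : ℂ) * hexParafermionicObservable (Λ (ns n)) (a (ns n)) hexCriticalFugacity (5 / 8) (b (ns n))))
    {w : ℂ} {k : Fin 6} {sw : ℝ} (hsw : 0 < sw) (hsetw : D.carrier ∩ ball w sw = halfPlane k w ∩ ball w sw)
    (hexw : ∀ᶠ δ : ℝ in 𝓝[>] 0, ∃ nthr : ℤ, ∀ v : HexVertex, (δ : ℂ) * hexCenter v ∈ ball w sw →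
      (v ∈ Λ δ ↔ nthr ≤ zigzagForm k v))
    (hrootw : D.pt 0 ∉ closedBall w sw) {w' : ℂ} (hw' : w' ∈ frontier D.carrier) (hd : dist w' w < sw / 2) :
    κ w' = κ w := by
  have hw'b : w' ∈ ball w sw := mem_ball.2 (by linarith)
  have hlev : ((w' - w) * conj (innerNormal k)).re = 0 := level_eq_zero_of_mem_frontier D.isOpen hsetw hw' hw'b
  -- the flat ball at `w'`
  set s₁ : ℝ := sw - dist w' w with hs₁
  have hs₁0 : sw / 2 < s₁ := by rw [hs₁]; linarith
  have hs₁w : s₁ ≤ sw := by rw [hs₁]; linarith [dist_nonneg (x := w') (y := w)]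
  have hsub : ball w' s₁ ⊆ ball w sw := fun y hy => by
    rw [mem_ball] at hy ⊢; have := dist_triangle y w' w; linarith
  have hset' : D.carrier ∩ ball w' s₁ = halfPlane k w' ∩ ball w' s₁ := flatBall_sub hsetw hlev le_rfl
  have hex' : ∀ᶠ δ : ℝ in 𝓝[>] 0, ∃ nthr : ℤ, ∀ v : HexVertex, (δ : ℂ) * hexCenter v ∈ ball w' s₁ →
      (v ∈ Λ δ ↔ nthr ≤ zigzagForm k v) := by
    filter_upwards [hexw] with δ ⟨nthr, h⟩
    exact ⟨nthr, fun v hv => h v (hsub hv)⟩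
  have hroot' : D.pt 0 ∉ closedBall w' s₁ := fun h => hrootw (by
    rw [mem_closedBall] at h ⊢; have := dist_triangle (D.pt 0) w' w; linarith)
  -- the eventual facts
  have E1 := hΘ2 w k sw hsw hexw hrootw
  have E2 := hΘ2 w' k s₁ (by linarith) hex' hroot'
  have E3 := hns.eventually (eventually_exists_dart_near hAF hPR hset' hex' hroot' (ε := s₁ / 4) (by linarith)
    (by linarith))
  have E4 := hns.eventually (boundary_norms hAF hPR)
  have hev : ∀ᶠ n in atTop, Θ n w' = Θ n w := by
    filter_upwards [E1, E2, E3, E4] with n h1 h2 h3 h4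
    obtain ⟨v, t, hv, ht, hvt, hvb⟩ := h3
    obtain ⟨hne, hbmem⟩ := h4
    have hvb1 : ((ns n : ℝ) : ℂ) * hexCenter v ∈ ball w (3 * sw / 4) := by
      rw [mem_ball] at hvb ⊢; have := dist_triangle (((ns n : ℝ) : ℂ) * hexCenter v) w' w; linarith
    have hvb2 : ((ns n : ℝ) : ℂ) * hexCenter v ∈ ball w' (3 * s₁ / 4) := ball_subset_ball (by linarith) hvb
    have i1 := h1 v t hv ht hvt hvb1
    have i2 := h2 v t hv ht hvt hvb2
    have he : s(v, t) ∈ hexDomainBoundary (Λ (ns n)) :=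
      ⟨(SimpleGraph.mem_edgeSet _).2 hvt, t, v, Sym2.eq_swap, hv, ht⟩
    have hZe : ((‖hexParafermionicObservable (Λ (ns n)) (a (ns n)) hexCriticalFugacity 0 s(v, t)‖ : ℝ) : ℂ) ≠ 0 :=
      Complex.ofReal_ne_zero.2 (hne _ he).2.ne'
    have hFb : hexParafermionicObservable (Λ (ns n)) (a (ns n)) hexCriticalFugacity (5 / 8) (b (ns n)) ≠ 0 := by
      intro h0
      have h := (hne _ hbmem).1
      rw [h0, norm_zero] at h
      exact (hne _ hbmem).2.ne' h.symm
    have h := i2.symm.trans i1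
    have h' : (Θ n w' - Θ n w) * (((‖hexParafermionicObservable (Λ (ns n)) (a (ns n)) hexCriticalFugacity 0 s(v, t)‖ : ℝ) : ℂ) *
        hexParafermionicObservable (Λ (ns n)) (a (ns n)) hexCriticalFugacity (5 / 8) (b (ns n))) = 0 := by
      linear_combination h
    rcases mul_eq_zero.1 h' with h0 | h0
    · exact sub_eq_zero.1 h0
    · exact absurd h0 (mul_ne_zero hZe hFb)
  exact tendsto_nhds_unique ((hκT w').congr' (hev.filter_mono hUle)) (hκT w)

/-! ### 3. Local constancy on flat balls (K2c) -/

/-- **K2c — `κ` is locally constant on flat stretches** (registered helper `kappa_const_on_flatBall` of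
`polygonLocalIdentity`): for a flat ball `B(z, s)` of form `k` off the root, `κ z' = κ z` for every
`z' ∈ ∂P ∩ B(z, s)` (chain of local steps along the segment `[z, z']`, whose points are centres of flat
sub-balls of radius `≥ s - dist z' z`). [folklore] -/
theorem kappa_const_on_flatBall : ∀ (D : DobrushinDomain) (ρ : ℝ) (Λ : ℝ → Finset HexVertex) (m : ℝ → ℤ) (b : ℝ → Sym2 HexVertex), AdmissibleFamily D ρ Λ m b → ∀ (a : ℝ → Sym2 HexVertex) (r₀ : ℝ) (m₀ : ℝ → ℤ), PinnedFlatRoot D Λ b (D.pt 0) a r₀ m₀ → ∀ (ns : ℕ → ℝ), Filter.Tendsto ns Filter.atTop (𝓝[>] 0) → ∀ (U : Filter ℕ) (Θ : ℕ → ℂ → ℂ) (κ : ℂ → ℂ), U ≤ Filter.atTop → U.NeBot → (∀ z : ℂ, Filter.Tendsto (fun n => Θ n z) U (𝓝 (κ z))) → (∀ (z : ℂ) (k : Fin 6) (s : ℝ), 0 < s → (∀ᶠ δ : ℝ in 𝓝[>] 0, ∃ nthr : ℤ, ∀ v : HexVertex, (δ : ℂ) * hexCenter v ∈ Metric.ball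 z s → (v ∈ Λ δ ↔ nthr ≤ zigzagForm k v)) → D.pt 0 ∉ Metric.closedBall z s → ∀ᶠ n : ℕ in Filter.atTop, ∀ v t : HexVertex, v ∈ Λ (ns n) → t ∉ Λ (ns n) → hexGraph.Adj v t → ((ns n : ℝ) : ℂ) * hexCenter v ∈ Metric.ball z (3 * s / 4) → hexParafermionicObservable (Λ (ns n)) (a (ns n)) hexCriticalFugacity (5 / 8) s(v, t) * ((‖hexParafermionicObservable (Λ (ns n)) (a (ns n)) hexCriticalFugacity 0 (b (ns n))‖ : ℝ) : ℂ) = Θ n z * ((‖hexParafermionicObservable (Λ (ns n)) (a (ns n)) hexCriticalFugacity 0 s(v, t)‖ : ℝ) : ℂ) * hexParafermionicObservable (Λ (ns n)) (a (ns n)) hexCriticalFugacity (5 / 8) (b (ns n))) → ∀ (z : ℂ) (k : Fin 6) (s : ℝ), 0 < s → D.carrier ∩ Metric.ball z s = halfPlane k z ∩ Metric.ball z s → (∀ᶠ δ : ℝ in 𝓝[>] 0, ∃ nthr : ℤ, ∀ v : HexVertex, (δ : ℂ) * hexCenter v ∈ Metric.ball z s → (v ∈ Λ δ ↔ nthr ≤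 zigzagForm k v)) → D.pt 0 ∉ Metric.closedBall z s → ∀ z' ∈ frontier D.carrier ∩ Metric.ball z s, κ z' = κ z := by
  intro D ρ Λ m b hAF a r₀ m₀ hPR ns hns U Θ κ hUle hUne hκT hΘ2 z k s hs hset hex hroot z' hz'
  haveI := hUne
  obtain ⟨hz'f, hz'b⟩ := hz'
  have hlev' : ((z' - z) * conj (innerNormal k)).re = 0 := level_eq_zero_of_mem_frontier D.isOpen hset hz'f hz'b
  set d : ℝ := dist z' z with hd
  have hd0 : 0 ≤ d := dist_nonneg
  have hds : d < s := mem_ball.1 hz'b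
  -- the points of the segment
  set wt : ℝ → ℂ := fun t => z + ((t : ℝ) : ℂ) * (z' - z) with hwt
  have hwt_dist : ∀ t : ℝ, 0 ≤ t → dist (wt t) z = t * d := fun t ht => by
    simp only [hwt]
    rw [dist_eq_norm, add_sub_cancel_left, norm_mul, Complex.norm_real, Real.norm_of_nonneg ht, hd, dist_eq_norm]
  have hwt_lev : ∀ t : ℝ, ((wt t - z) * conj (innerNormal k)).re = 0 := fun t => by
    simp only [hwt]
    rw [add_sub_cancel_left, mul_assoc, Complex.re_ofReal_mul, hlev', mul_zero]
  have hwt_sub : ∀ t t' : ℝ, dist (wt t') (wt t) = |t' - t| * d := fun t t' => by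
    simp only [hwt]
    rw [dist_eq_norm, show z + ((t' : ℝ) : ℂ) * (z' - z) - (z + ((t : ℝ) : ℂ) * (z' - z)) =
      (((t' - t : ℝ)) : ℂ) * (z' - z) by push_cast; ring, norm_mul, Complex.norm_real, Real.norm_eq_abs, hd,
      dist_eq_norm]
  -- flat data at the points of the segment, `t ∈ [0, 1]`
  have hflat : ∀ t : ℝ, 0 ≤ t → t ≤ 1 →
      wt t ∈ frontier D.carrier ∧
      D.carrier ∩ ball (wt t) (s - d) = halfPlane k (wt t) ∩ ball (wt t) (s - d) ∧
      (∀ᶠ δ : ℝ in 𝓝[>] 0, ∃ nthr : ℤ, ∀ v : HexVertex, (δ : ℂ) * hexCenter v ∈ ball (wt t) (s - d) →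
        (v ∈ Λ δ ↔ nthr ≤ zigzagForm k v)) ∧
      D.pt 0 ∉ closedBall (wt t) (s - d) := by
    intro t ht0 ht1
    have hdt : dist (wt t) z ≤ d := by rw [hwt_dist t ht0]; nlinarith
    have hball : wt t ∈ ball z s := mem_ball.2 (by linarith)
    have hsub : ball (wt t) (s - d) ⊆ ball z s := fun y hy => by
      rw [mem_ball] at hy ⊢; have := dist_triangle y (wt t) z; linarith
    refine ⟨mem_frontier_of_level_eq_zero D.isOpen hset hball (hwt_lev t),
      flatBall_sub hset (hwt_lev t) (by linarith), ?_, fun h => hroot ?_⟩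
    · filter_upwards [hex] with δ ⟨nthr, h⟩
      exact ⟨nthr, fun v hv => h v (hsub hv)⟩
    · rw [mem_closedBall] at h ⊢; have := dist_triangle (D.pt 0) (wt t) z; linarith
  -- the chain
  obtain ⟨N, hN⟩ : ∃ N : ℕ, 2 * d < (N : ℝ) * (s - d) ∧ 0 < N := by
    obtain ⟨N, hN⟩ := exists_nat_gt (2 * d / (s - d))
    refine ⟨N + 1, ?_, Nat.succ_pos N⟩
    have hsd : 0 < s - d := by linarith
    rw [div_lt_iff₀ hsd] at hN
    push_cast; nlinarith
  have hNpos : (0 : ℝ) < N := by exact_mod_cast hN.2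
  have hstep : ∀ i : ℕ, i + 1 ≤ N → κ (wt ((i + 1 : ℕ) / N)) = κ (wt ((i : ℕ) / N)) := by
    intro i hi
    have hi0 : (0 : ℝ) ≤ (i : ℕ) / N := by positivity
    have hi1 : ((i : ℕ) : ℝ) / N ≤ 1 := by
      rw [div_le_one hNpos]; exact_mod_cast (Nat.le_succ i).trans hi
    obtain ⟨-, hsetw, hexw, hrootw⟩ := hflat _ hi0 hi1
    obtain ⟨hfr', -, -, -⟩ := hflat ((i + 1 : ℕ) / N) (by positivity) (by
      rw [div_le_one hNpos]; exact_mod_cast hi)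
    refine kappa_localStep hAF hPR hns hUle hκT hΘ2 (by linarith) hsetw hexw hrootw hfr' ?_
    rw [hwt_sub]
    have : |((i + 1 : ℕ) : ℝ) / N - ((i : ℕ) : ℝ) / N| = 1 / N := by
      rw [← sub_div, abs_div, abs_of_pos hNpos]
      push_cast
      rw [show ((i : ℝ) + 1 - i) = 1 by ring, abs_one]
    rw [this]
    rw [div_mul_eq_mul_div, one_mul, div_lt_iff₀ hNpos]
    linarith [hN.1]
  have hchain : ∀ i : ℕ, i ≤ N → κ (wt ((i : ℕ) / N)) = κ z := by
    intro i
    induction i with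
    | zero => intro _; simp [hwt]
    | succ i ih => intro hi; rw [hstep i hi]; exact ih ((Nat.le_succ i).trans hi)
  have := hchain N le_rfl
  rw [div_self hNpos.ne'] at this
  simpa [hwt] using this

/-! ### 4. The gate normalisation (K3) -/

/-- **K3 — `κ = 1` on the gate.**  On the gate ball `B(pt 1, ρ)` (flat of form `0`, exact with
threshold `m δ`, off the root as `2ρ < dist (pt 0, pt 1)`), `κ z = κ (pt 1)` by K2c, and
`κ (pt 1) = 1`: a dart near `pt 1` carries the phase `Θ_n(pt 1)` and, compared with the normaliser
`b_δ` (whose scaled midpoint tends to `pt 1`) by `flat_phase_eq`, the trivial phase. [folklore] -/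
theorem kappa_gate_eq_one {D : DobrushinDomain} {ρ : ℝ} {Λ : ℝ → Finset HexVertex} {m : ℝ → ℤ}
    {b : ℝ → Sym2 HexVertex} (hAF : AdmissibleFamily D ρ Λ m b) {a : ℝ → Sym2 HexVertex} {r₀ : ℝ}
    {m₀ : ℝ → ℤ} (hPR : PinnedFlatRoot D Λ b (D.pt 0) a r₀ m₀) (hdist : 2 * ρ < dist (D.pt 0) (D.pt 1))
    {ns : ℕ → ℝ} (hns : Tendsto ns atTop (𝓝[>] 0)) {U : Filter ℕ} (hUle : U ≤ atTop) [U.NeBot]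
    {Θ : ℕ → ℂ → ℂ} {κ : ℂ → ℂ} (hκT : ∀ z : ℂ, Tendsto (fun n => Θ n z) U (𝓝 (κ z)))
    (hΘ2 : (∀ (z : ℂ) (k : Fin 6) (s : ℝ), 0 < s → (∀ᶠ δ : ℝ in 𝓝[>] 0, ∃ nthr : ℤ, ∀ v : HexVertex, (δ : ℂ) * hexCenter v ∈ Metric.ball z s → (v ∈ Λ δ ↔ nthr ≤ zigzagForm k v)) → D.pt 0 ∉ Metric.closedBall z s → ∀ᶠ n : ℕ in Filter.atTop, ∀ v t : HexVertex, v ∈ Λ (ns n) → t ∉ Λ (ns n) → hexGraph.Adj v t → ((ns n : ℝ) : ℂ) * hexCenter v ∈ Metric.ball z (3 * s / 4) → hexParafermionicObservable (Λ (ns n)) (a (ns n)) hexCriticalFugacity (5 / 8) s(v, t) * ((‖hexParafermionicObservable (Λ (ns n)) (a (ns n)) hexCriticalFugacity 0 (b (ns n))‖ : ℝ) : ℂ) = Θ n z * ((‖hexParafermionicObservable (Λ (ns n)) (a (ns n)) hexCriticalFugacity 0 s(v, t)‖ : ℝ) : ℂ) * hexParafermionicObservable (Λ (ns n)) (a (ns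 n)) hexCriticalFugacity (5 / 8) (b (ns n)))) :
    ∀ z ∈ frontier D.carrier ∩ ball (D.pt 1) ρ, κ z = 1 := by
  have hρ := hAF.1
  have hgate := hAF.2.1
  have hadm := hAF.2.2.1
  have hbt := hAF.2.2.2.2
  -- the gate ball is flat of form `0`
  have hset : D.carrier ∩ ball (D.pt 1) ρ = halfPlane 0 (D.pt 1) ∩ ball (D.pt 1) ρ := by
    rw [halfPlane_zero]; exact hgate
  have hex : ∀ᶠ δ : ℝ in 𝓝[>] 0, ∃ nthr : ℤ, ∀ v : HexVertex, (δ : ℂ) * hexCenter v ∈ ball (D.pt 1) ρ →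
      (v ∈ Λ δ ↔ nthr ≤ zigzagForm 0 v) := by
    filter_upwards [hadm] with δ h
    exact ⟨m δ, fun v hv => by rw [h.2.2.2.2 v hv]; simp [zigzagForm]⟩
  have hroot : D.pt 0 ∉ closedBall (D.pt 1) ρ := fun h => by
    rw [mem_closedBall] at h; linarith
  intro z hz
  have h1 := kappa_const_on_flatBall D ρ Λ m b hAF a r₀ m₀ hPR ns hns U Θ κ hUle ‹_› hκT
    hΘ2 (D.pt 1) 0 ρ hρ hset hex hroot z hz
  rw [h1]
  -- `κ (pt 1) = 1`
  have E1 := hΘ2 (D.pt 1) 0 ρ hρ hex hroot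
  have E2 := hns.eventually (flat_phase_eq D ρ Λ m b hAF a r₀ m₀ hPR (D.pt 1) 0 ρ
    (3 * ρ / 4) (by linarith) hex hroot)
  have E3 := hns.eventually (eventually_exists_dart_near hAF hPR hset hex hroot
    (ε := ρ / 4) (by linarith) (by linarith))
  have E4 := hns.eventually (boundary_norms hAF hPR)
  have E5 : ∀ᶠ n in atTop, ((ns n : ℝ) : ℂ) * hexMidpoint (b (ns n)) ∈ ball (D.pt 1) (ρ / 2) :=
    hns.eventually (hbt (isOpen_ball.mem_nhds (mem_ball_self (by linarith))))
  have E6 : ∀ᶠ n in atTop, ns n < ρ / 4 := hns.eventually (nhdsWithin_le_nhds (eventually_lt_nhds (by linarith)))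
  have E7 := hns.eventually (self_mem_nhdsWithin : Ioi (0 : ℝ) ∈ 𝓝[>] (0 : ℝ))
  have hev : ∀ᶠ n in atTop, Θ n (D.pt 1) = 1 := by
    filter_upwards [E1, E2, E3, E4, E5, E6, E7] with n h1 h2 h3 h4 h5 h6 h7
    obtain ⟨v, t, hv, ht, hvt, hvb⟩ := h3
    obtain ⟨hne, hbmem⟩ := h4
    have he : s(v, t) ∈ hexDomainBoundary (Λ (ns n)) :=
      ⟨(SimpleGraph.mem_edgeSet _).2 hvt, t, v, Sym2.eq_swap, hv, ht⟩
    have i1 := h1 v t hv ht hvt (ball_subset_ball (by linarith) hvb)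
    have hmid : ((ns n : ℝ) : ℂ) * hexMidpoint s(v, t) ∈ ball (D.pt 1) (3 * ρ / 4) := by
      have hdm := ConjugateClassNegligibleSynthesis.dist_mid_center_le (le_of_lt h7) hvt
      rw [mem_ball] at hvb ⊢
      have := dist_triangle (((ns n : ℝ) : ℂ) * hexMidpoint s(v, t)) (((ns n : ℝ) : ℂ) * hexCenter v) (D.pt 1)
      linarith
    have i2 := h2 _ he _ hbmem hmid (ball_subset_ball (by linarith) h5)
    have hZe : ((‖hexParafermionicObservable (Λ (ns n)) (a (ns n)) hexCriticalFugacity 0 s(v, t)‖ : ℝ) : ℂ) ≠ 0 :=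
      Complex.ofReal_ne_zero.2 (hne _ he).2.ne'
    have hFb : hexParafermionicObservable (Λ (ns n)) (a (ns n)) hexCriticalFugacity (5 / 8) (b (ns n)) ≠ 0 := by
      intro h0
      have h := (hne _ hbmem).1
      rw [h0, norm_zero] at h
      exact (hne _ hbmem).2.ne' h.symm
    have h' : (Θ n (D.pt 1) - 1) * (((‖hexParafermionicObservable (Λ (ns n)) (a (ns n)) hexCriticalFugacity 0 s(v, t)‖ : ℝ) : ℂ) *
        hexParafermionicObservable (Λ (ns n)) (a (ns n)) hexCriticalFugacity (5 / 8) (b (ns n))) = 0 := by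
      linear_combination i2 - i1
    rcases mul_eq_zero.1 h' with h0 | h0
    · exact sub_eq_zero.1 h0
    · exact absurd h0 (mul_ne_zero hZe hFb)
  exact tendsto_nhds_unique ((hκT (D.pt 1)).congr' (hev.filter_mono hUle)) tendsto_const_nhds

end Summit.CriticalPhenomena.SAWScalingLimit.Theorems.PolygonParitySqueeze.PolygonLocal

end
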